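import Mathlib
import HarnessLib
import Summits.ResolutionOfSingularities.ResolutionOfSingularities.Theorems.HomologicalConductorSurfaceTerminationNegDefSupport

/-!
# Kill test `SurfaceTermination` (stmt-ResolutionOfSingularities-16488), THEOREM 23-S∞ step (S4) —
# the LATTICE of ANTI-NEF CYCLES on a negative-definite form with non-negative off-diagonal entries

Route `ResolutionOfSingularities/HomologicalConductor`, crux chain W4.4 (lead g24; CRUX-PLAN v10.10 (E) Lean targets (e1)/(e2),
KERNEL-g24 §1.4–1.5).  `[OURS]` — AI-formalised, weaker than expert review; NOT a statement of the manuscript under review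
(Hironaka 2017); ℤ-valued data only (`Q : Matrix (Fin n) (Fin n) ℤ` = the intersection form of an exceptional configuration
`E₁,…,E_n`, `Z : Fin n → ℤ` = a cycle, «anti-nef» = `∀ i, (Q Z)_i = Z·E_i ≤ 0`), no resolution or cohomology-annihilator
infrastructure; builds on p704166 (`…SurfaceTerminationNegDefSupport`, lead g22).

* `mulVec_inf_apply_le` / `antinef_inf` — if `Q_{ij} ≥ 0` for `i ≠ j` (distinct curves meet non-negatively) then the
  componentwise MINIMUM of two anti-nef cycles is anti-nef.  (The componentwise MAXIMUM is not: `A₃`, `(3,2,1)`, `(1,2,3)`;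
  KERNEL-g24 §1 W1.)
* `exists_least_antinef_ge` — hence for every cycle `A` below some anti-nef cycle there is a LEAST anti-nef cycle `A⁺ ≥ A`
  (Laufer / Lipman: `Γ(X, 𝒪(−A)) = Γ(X, 𝒪(−A⁺)) = I_{A⁺}`; used in 23-S∞ (S4) and for `ca = I_{(max A_M)⁺}`).
* `exists_mulVec_neg_of_ne_zero` — (e1), the lattice half of LEMMA BPF-STEP: on a NEGATIVE-DEFINITE form a non-zero
  anti-nef cycle `A` has `A·E_j < 0` for some `j` (so `{E_j : A·E_j = 0}` is a PROPER sub-configuration and `NBl_{I_A}`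
  contracts at least one curve).
* `nonneg_of_antinef` — anti-nef cycles are EFFECTIVE (negative-definite, off-diagonal `≥ 0`): the classical
  `Z = Z⁺ − Z⁻`, `Z⁻·Z ≤ 0 ≤ Z⁻·Z⁺`, `Z⁻·Z⁻ < 0` argument.
-/

-- single-problem summit: the doubled namespace component is forced
set_option linter.dupNamespace false

namespace Summit.ResolutionOfSingularities.ResolutionOfSingularities.Theorems.NoZeno.AntinefLattice

open Matrix Finset
open Summit.ResolutionOfSingularities.ResolutionOfSingularities.Theorems.NoZeno.NegDefSupport

/-! ## Minima of anti-nef cycles -/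

/-- If the off-diagonal entries of `Q` are non-negative and `Z_i ≤ W_i`, then `(Q·(Z ⊓ W))_i ≤ (Q·Z)_i`: the diagonal
term is the same and every other term only decreases. [folklore] -/
theorem mulVec_inf_apply_le {n : ℕ} (Q : Matrix (Fin n) (Fin n) ℤ) (hoff : ∀ i j, i ≠ j → 0 ≤ Q i j)
    (Z W : Fin n → ℤ) (i : Fin n) (hi : Z i ≤ W i) :
    (Q *ᵥ (Z ⊓ W)) i ≤ (Q *ᵥ Z) i := by
  simp only [Matrix.mulVec, dotProduct]
  refine Finset.sum_le_sum fun j _ => ?_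
  by_cases hij : i = j
  · subst hij
    rw [Pi.inf_apply, inf_eq_left.mpr hi]
  · exact mul_le_mul_of_nonneg_left (by rw [Pi.inf_apply]; exact inf_le_left) (hoff i j hij)

/-- **The minimum of two anti-nef cycles is anti-nef** (off-diagonal entries `≥ 0`). [folklore; Lipman 1969 §18 / Laufer] -/
theorem antinef_inf {n : ℕ} (Q : Matrix (Fin n) (Fin n) ℤ) (hoff : ∀ i j, i ≠ j → 0 ≤ Q i j)
    {Z W : Fin n → ℤ} (hZ : ∀ i, (Q *ᵥ Z) i ≤ 0) (hW : ∀ i, (Q *ᵥ W) i ≤ 0) (i : Fin n) :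
    (Q *ᵥ (Z ⊓ W)) i ≤ 0 := by
  rcases le_total (Z i) (W i) with h | h
  · exact (mulVec_inf_apply_le Q hoff Z W i h).trans (hZ i)
  · rw [inf_comm]
    exact (mulVec_inf_apply_le Q hoff W Z i h).trans (hW i)

/-- **The least anti-nef cycle above `A`** (off-diagonal entries `≥ 0`): if some anti-nef cycle lies above `A`, there is a
least one, `A⁺` — the coordinatewise infimum of all of them, which is again anti-nef because each coordinate is
attained by a member. [folklore; Laufer's computation sequence / Lipman 1969 §18] -/
theorem exists_least_antinef_ge {n : ℕ} (Q : Matrix (Fin n) (Fin n) ℤ) (hoff : ∀ i j, i ≠ j → 0 ≤ Q i j)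
    (A : Fin n → ℤ) (h : ∃ Z : Fin n → ℤ, A ≤ Z ∧ ∀ i, (Q *ᵥ Z) i ≤ 0) :
    ∃ P : Fin n → ℤ, A ≤ P ∧ (∀ i, (Q *ᵥ P) i ≤ 0) ∧
      ∀ Z : Fin n → ℤ, A ≤ Z → (∀ i, (Q *ᵥ Z) i ≤ 0) → P ≤ Z := by
  classical
  set S : Set (Fin n → ℤ) := {Z | A ≤ Z ∧ ∀ i, (Q *ᵥ Z) i ≤ 0} with hS
  have hSne : S.Nonempty := h
  have hbdd : ∀ i, BddBelow ((fun Z : Fin n → ℤ => Z i) '' S) := fun i =>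
    ⟨A i, by rintro _ ⟨Z, hZ, rfl⟩; exact hZ.1 i⟩
  have hne' : ∀ i, ((fun Z : Fin n → ℤ => Z i) '' S).Nonempty := fun i => hSne.image _
  let P : Fin n → ℤ := fun i => sInf ((fun Z : Fin n → ℤ => Z i) '' S)
  have hPle : ∀ Z ∈ S, P ≤ Z := fun Z hZ i => csInf_le (hbdd i) ⟨Z, hZ, rfl⟩
  have hatt : ∀ i, ∃ Z ∈ S, Z i = P i := fun i => by
    obtain ⟨Z, hZ, hZi⟩ := Int.csInf_mem (hne' i) (hbdd i)
    exact ⟨Z, hZ, hZi⟩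
  refine ⟨P, fun i => le_csInf (hne' i) ?_, fun i => ?_, fun Z hA hZ => hPle Z ⟨hA, hZ⟩⟩
  · rintro _ ⟨Z, hZ, rfl⟩
    exact hZ.1 i
  · obtain ⟨Z, hZS, hZi⟩ := hatt i
    have hle : (Q *ᵥ P) i ≤ (Q *ᵥ Z) i := by
      simp only [Matrix.mulVec, dotProduct]
      refine Finset.sum_le_sum fun j _ => ?_
      by_cases hij : i = j
      · subst hij
        rw [hZi]
      · exact mul_le_mul_of_nonneg_left (hPle Z hZS j) (hoff i j hij)
    exact hle.trans (hZS.2 i)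

/-! ## Negative definiteness -/

/-- **(e1) A non-zero anti-nef cycle meets some curve negatively** on a negative-definite form: `Zᵀ Q Z < 0` forbids
`Q Z = 0`, and an anti-nef `Q Z ≠ 0` has a negative entry.  (No sign hypothesis on `Z` or on the off-diagonal entries.)
[this work; the lattice half of LEMMA BPF-STEP, desk DN143 / CRUX-PLAN v10.10 (E)(e1)] -/
theorem exists_mulVec_neg_of_ne_zero {n : ℕ} (Q : Matrix (Fin n) (Fin n) ℤ)
    (hneg : (-(Q.map (Int.cast : ℤ → ℚ))).PosDef)
    (Z : Fin n → ℤ) (hZ0 : Z ≠ 0) (hanti : ∀ i, (Q *ᵥ Z) i ≤ 0) :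
    ∃ j, (Q *ᵥ Z) j < 0 := by
  by_contra hcon
  simp only [not_exists, not_lt] at hcon
  have hQZ : ∀ j, (Q *ᵥ Z) j = 0 := fun j => le_antisymm (hanti j) (hcon j)
  set x : Fin n → ℚ := fun j => (Z j : ℚ) with hx
  have hx0 : x ≠ 0 := by
    intro h
    apply hZ0
    funext i
    have := congrFun h i
    simpa [hx] using this
  have hpos := (Matrix.PosDef.dotProduct_mulVec_pos hneg) hx0
  have hq : dotProduct (star x) ((-(Q.map (Int.cast : ℤ → ℚ))).mulVec x) =
      -(((∑ j, Z j * (Q.mulVec Z) j : ℤ) : ℚ)) := by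
    rw [cast_sum_mul_mulVec, Matrix.neg_mulVec, dotProduct_neg]
    rfl
  rw [hq] at hpos
  have hsum : (∑ j, Z j * (Q.mulVec Z) j : ℤ) = 0 := Finset.sum_eq_zero fun j _ => by rw [hQZ j, mul_zero]
  rw [hsum] at hpos
  simp at hpos

/-- **Anti-nef cycles are effective** on a negative-definite form with non-negative off-diagonal entries: if
`(Q Z)_i ≤ 0` for all `i` then `Z ≥ 0`.  Proof: with `N := Z⁻ ≥ 0` and `Z = Z⁺ − N` (disjoint supports),
`Σ_i N_i (QZ)_i ≤ 0`, while `Σ_{i,j} N_i Q_{ij} Z⁺_j ≥ 0` (diagonal terms vanish) and `−Nᵀ Q N > 0` if `N ≠ 0`.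
[folklore; e.g. Lipman 1969 §18, Artin 1966] -/
theorem nonneg_of_antinef {n : ℕ} (Q : Matrix (Fin n) (Fin n) ℤ)
    (hneg : (-(Q.map (Int.cast : ℤ → ℚ))).PosDef) (hoff : ∀ i j, i ≠ j → 0 ≤ Q i j)
    (Z : Fin n → ℤ) (hanti : ∀ i, (Q *ᵥ Z) i ≤ 0) : 0 ≤ Z := by
  classical
  -- negative and positive parts
  set N : Fin n → ℤ := fun i => max (-Z i) 0 with hN
  set Zp : Fin n → ℤ := fun i => max (Z i) 0 with hZp
  have hNnn : ∀ i, 0 ≤ N i := fun i => le_max_right _ _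
  have hZpnn : ∀ i, 0 ≤ Zp i := fun i => le_max_right _ _
  have hdec : ∀ i, Z i = Zp i - N i := fun i => by
    simp only [hN, hZp]
    rcases le_total 0 (Z i) with h | h
    · rw [max_eq_left h, max_eq_right (by linarith), sub_zero]
    · rw [max_eq_right h, max_eq_left (by linarith)]; ring
  have hdisj : ∀ i, N i * Zp i = 0 := fun i => by
    simp only [hN, hZp]
    rcases le_total 0 (Z i) with h | h
    · rw [max_eq_right (by linarith : -Z i ≤ 0), zero_mul]
    · rw [max_eq_right h, mul_zero]
  by_contra hcon
  have hN0 : N ≠ 0 := by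
    intro h
    apply hcon
    intro i
    have hi := congrFun h i
    simp only [hN, Pi.zero_apply] at hi
    have : -Z i ≤ 0 := by rw [← hi]; exact le_max_left _ _
    simpa using this
  -- (1) Σ_i N_i (QZ)_i ≤ 0
  have h1 : ∑ i, N i * (Q *ᵥ Z) i ≤ 0 :=
    Finset.sum_nonpos fun i _ => mul_nonpos_of_nonneg_of_nonpos (hNnn i) (hanti i)
  -- (2) expand: Σ_i N_i (QZ)_i = Σ_i Σ_j N_i Q_ij Zp_j − Σ_i N_i (QN)_i
  have h2 : ∑ i, N i * (Q *ᵥ Z) i =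
      (∑ i, ∑ j, N i * (Q i j * Zp j)) - ∑ i, N i * (Q *ᵥ N) i := by
    simp only [Matrix.mulVec, dotProduct, Finset.mul_sum, ← Finset.sum_sub_distrib]
    refine Finset.sum_congr rfl fun i _ => Finset.sum_congr rfl fun j _ => ?_
    rw [hdec j]
    ring
  -- (3) the mixed term is ≥ 0
  have h3 : 0 ≤ ∑ i, ∑ j, N i * (Q i j * Zp j) := by
    refine Finset.sum_nonneg fun i _ => Finset.sum_nonneg fun j _ => ?_
    by_cases hij : i = j
    · subst hij
      rw [mul_left_comm, hdisj, mul_zero]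
    · exact mul_nonneg (hNnn i) (mul_nonneg (hoff i j hij) (hZpnn j))
  -- (4) Nᵀ Q N < 0
  have h4 : ∑ i, N i * (Q *ᵥ N) i < 0 := by
    set x : Fin n → ℚ := fun j => (N j : ℚ) with hx
    have hx0 : x ≠ 0 := by
      intro h
      apply hN0
      funext i
      have := congrFun h i
      simpa [hx] using this
    have hpos := (Matrix.PosDef.dotProduct_mulVec_pos hneg) hx0
    have hq : dotProduct (star x) ((-(Q.map (Int.cast : ℤ → ℚ))).mulVec x) =
        -(((∑ j, N j * (Q.mulVec N) j : ℤ) : ℚ)) := by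
      rw [cast_sum_mul_mulVec, Matrix.neg_mulVec, dotProduct_neg]
      rfl
    rw [hq] at hpos
    exact_mod_cast (neg_pos.mp hpos)
  -- contradiction
  rw [h2] at h1
  linarith

end Summit.ResolutionOfSingularities.ResolutionOfSingularities.Theorems.NoZeno.AntinefLattice
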